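import Summits.BirchSwinnertonDyer.BirchSwinnertonDyer.Theorems.AdditiveKolyvaginRoadRamifiedHabitatSignLawStarred
import Literature.NumberTheory.DiophantineGeometry.ConductorExponentZeroProofs
import Literature.NumberTheory.DiophantineGeometry.ConductorAdditiveProofs
import Literature.NumberTheory.DiophantineGeometry.ConductorFactorizationProofs
import Literature.NumberTheory.EllipticCurves.RootNumberProofs
import HarnessLib

/-!
# Route `AdditiveKolyvaginRoad`, crux KS′ `LevelKolyvaginSystemsAdditive` (stmt-BirchSwinnertonDyer-21396), card `ramified-toric-habitat` —
# part 8: Kodaira type I₀* (`e = 2`) — the twist `E^{(p*)}` is GOOD at `p` and the ramified-habitat sign is `−1`, UNCONDITIONALLY modulo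
# the Modularity Theorem

Cell `pub/bsd-wall`, width seat `bsd-wall-akr-p2x-w2` g11; `--supports stmt-BirchSwinnertonDyer-21396` (helper). THEOREMS ONLY; no definition,
no named fact, no `sorry`. BSD is not proved by any of this; KS′/KPA′ stay OPEN at `p² ∣ N`.

Parts 1–7 treat `e ∈ {3, 4, 6}`, where `E^{(p*)}` is again additive at `p` and Kellock–Dokchitser's Remark 2.2 at `p` is a named fact. The
remaining potentially good additive type at `p ≥ 5` is I₀* (`ord_p Δ_min = 6`, `e = 2`): there `E^{(p*)}` has GOOD reduction at `p`
(part 5's rescaled model has `ord_p Δ = 0`), `N_{E^{(p*)}} = M`, and Remark 2.2 at `p` is the tree's THEOREM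
`atkinLehnerEigenvalueAt_eq_localRootNumberAt_of_twist` (quadratic-twist type). Hence:

* `hasGoodReduction_pStarTwist_padic_of_six`, `conductorNorm_pStarTwist_mul_sq_eq_of_good` — the local data and `N_{E'} = M`;
* `rootNumber_mul_rootNumber_pStarTwist_eq_legendreSym_mul_of_good` — Atkin–Lehner-formal: `w(E)·w(E') = (M/p)·λ_p(f)` (`N' = M`);
* `rootNumber_mul_rootNumber_pStarTwist_of_six` — `w(E)·w(E^{(p*)}) = (M/p)·(−1/p)`, assuming ONLY `exists_isNewformOf`;
* `rootNumber_mul_rootNumber_ramifiedTwist_of_six` — in the `p`-ramified habitat (all primes of `M` split) **`w(E)·w(E^{(d)}) = −1`**, assuming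
  only `exists_isNewformOf`: type I₀* never has the definite habitat (principal series, `e = 2 ∣ p − 1`).

With parts 3, 4, 6, 7 this completes the card's sign table on every ADDITIVE POTENTIALLY GOOD `p ≥ 5` for `E` semistable away from `p` and odd
`d`; the potentially multiplicative rows are where the sketch's `SignLawPrincipalSeries` fails (evidence #41 on the crux item).

References: [cite: KellockDokchitser2023, Rem. 2.2 and Thm. 2.3] [cite: Rohrlich1993Compositio, Prop. 2(iii),(iv)] [cite: MurtyMurty1997, Ch. 6 §1]
[cite: Silverman1994, IV.10.2 and IV.10.4] [cite: Knapp1993, Thm. 9.27].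
-/

set_option autoImplicit false
set_option linter.dupNamespace false

noncomputable section

open scoped Classical MatrixGroups

open CongruenceSubgroup IsDedekindDomain IsDedekindDomain.HeightOneSpectrum NumberField Rat.HeightOneSpectrum
  WeierstrassCurve Literature.NumberTheory.EllipticCurves Literature.NumberTheory.EllipticCurves.ModularForms
  IsDiscreteValuationRing

namespace Summit.BirchSwinnertonDyer.BirchSwinnertonDyer.Theorems.AdditiveKoly.RamifiedHabitat

/-! ## §9 Type I₀* (`e = 2`): `E^{(p*)}` is GOOD at `p`, and the habitat sign is `−1` UNCONDITIONALLY modulo the Modularity Theorem -/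

section IZeroStar

open scoped NumberTheorySymbols

variable {p : ℕ} [Fact p.Prime]

/-- **Type I₀* at `p`: the twist `E^{(p*)}` has GOOD reduction and `W_p(E) = (−1/p)`.** Let `X` be the chosen `ℤ_p`-minimal model of `E/ℚ_p`,
`p ≥ 5`, with `ord_p Δ(X) = 6`, `ord_p c₄(X) > 0`, `3 ord_p c₄ ≥ ord_p Δ` (additive potentially good, `e = 2`). Then `ord_p c₄ ≥ 2`,
`ord_p c₆ ≥ 3` (`c₄³ − c₆² = 1728Δ`), part 5's rescaled model of `E^{(p*)}` has `ord_p Δ = 0` — GOOD reduction — and Rohrlich's list gives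
`W_p(E) = (−1/p)`. [cite: Rohrlich1993Compositio, Prop. 2(iv)] [cite: SilvermanAEC2009, VII.1 Remark 1.1] -/
theorem hasGoodReduction_pStarTwist_padic_of_six (W : WeierstrassCurve ℚ) [W.IsElliptic] (hp5 : 5 ≤ p)
    (hΔ : addVal ℤ_[p] (((W.baseChange ℚ_[p]).minimal ℤ_[p]).integralModel ℤ_[p]).Δ = (6 : ℕ))
    (hc₄ : addVal ℤ_[p] (((W.baseChange ℚ_[p]).minimal ℤ_[p]).integralModel ℤ_[p]).c₄ ≠ 0)
    (hj : ¬ 3 * addVal ℤ_[p] (((W.baseChange ℚ_[p]).minimal ℤ_[p]).integralModel ℤ_[p]).c₄ <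
      addVal ℤ_[p] (((W.baseChange ℚ_[p]).minimal ℤ_[p]).integralModel ℤ_[p]).Δ) :
    ((W.baseChange ℚ_[p]).minimal ℤ_[p]).HasAdditiveReduction ℤ_[p] ∧
      (((W.quadraticTwist (((-1 : ℤ) ^ (p / 2) * p : ℤ) : ℚ)).baseChange ℚ_[p]).minimal ℤ_[p]).HasGoodReduction ℤ_[p] ∧
      (W.baseChange ℚ_[p]).localRootNumber ℤ_[p] = ZMod.χ₄ p := by
  set I := ((W.baseChange ℚ_[p]).minimal ℤ_[p]).integralModel ℤ_[p] with hI
  -- `ord c₄ ≥ 2`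
  have hc2 : (2 : ℕ∞) ≤ addVal ℤ_[p] I.c₄ := by
    by_cases htop : addVal ℤ_[p] I.c₄ = ⊤
    · rw [htop]; exact le_top
    · obtain ⟨c, hc⟩ := ENat.ne_top_iff_exists.mp htop
      rw [← hc] at hj ⊢
      rw [hΔ] at hj
      have h1 : ¬ ((3 * c : ℕ) : ℕ∞) < ((6 : ℕ) : ℕ∞) := by push_cast at hj ⊢; exact hj
      have h2 : ¬ 3 * c < 6 := fun h ↦ h1 (by exact_mod_cast h)
      exact_mod_cast (show 2 ≤ c by omega)
  -- `ord c₆ ≥ 3`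
  have hc₆ : (3 : ℕ∞) ≤ addVal ℤ_[p] I.c₆ := by
    have hrel : I.c₆ ^ 2 = I.c₄ ^ 3 - 1728 * I.Δ := by linear_combination I.c_relation
    have h1 : min (addVal ℤ_[p] (I.c₄ ^ 3)) (addVal ℤ_[p] (1728 * I.Δ)) ≤ addVal ℤ_[p] (I.c₆ ^ 2) := by
      rw [hrel]; exact AddValuation.map_sub _ _ _
    rw [IsDiscreteValuationRing.addVal_pow, IsDiscreteValuationRing.addVal_pow, IsDiscreteValuationRing.addVal_mul, hΔ] at h1
    have h6 : (6 : ℕ∞) ≤ min (3 • addVal ℤ_[p] I.c₄) (addVal ℤ_[p] (1728 : ℤ_[p]) + ((6 : ℕ) : ℕ∞)) := by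
      refine le_min ?_ ?_
      · calc (6 : ℕ∞) ≤ 3 • (2 : ℕ∞) := by norm_num
          _ ≤ 3 • addVal ℤ_[p] I.c₄ := nsmul_le_nsmul_right hc2 3
      · calc (6 : ℕ∞) ≤ ((6 : ℕ) : ℕ∞) := by norm_num
          _ ≤ _ := le_add_self
    have h2 : (6 : ℕ∞) ≤ 2 • addVal ℤ_[p] I.c₆ := h6.trans h1
    by_cases htop : addVal ℤ_[p] I.c₆ = ⊤
    · rw [htop]; exact le_top
    · obtain ⟨s, hs⟩ := ENat.ne_top_iff_exists.mp htop
      rw [← hs] at h2 ⊢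
      have h3 : ((6 : ℕ) : ℕ∞) ≤ ((2 * s : ℕ) : ℕ∞) := by
        rw [Nat.cast_mul]; simpa [nsmul_eq_mul] using h2
      have h4 : 6 ≤ 2 * s := by exact_mod_cast h3
      exact_mod_cast (show 3 ≤ s by omega)
  obtain ⟨hΔ', -⟩ := addVal_minimal_pStarTwist_padic_of_ge W hp5 hΔ (by norm_num) (by norm_num) hc2 hc₆
  have ha0 : addVal ℤ_[p] I.Δ ≠ 0 := by rw [hΔ]; norm_num
  have hadd := hasAdditiveReduction_minimal_padic_of_addVal (W.baseChange ℚ_[p]) ha0 hc₄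
  refine ⟨hadd, ?_, ?_⟩
  · -- good reduction of the twist: `ord Δ = 0`
    set X' := ((W.quadraticTwist (((-1 : ℤ) ^ (p / 2) * p : ℤ) : ℚ)).baseChange ℚ_[p]).minimal ℤ_[p] with hX'
    have h0 : addVal ℤ_[p] (X'.integralModel ℤ_[p]).Δ = 0 := by rw [hΔ']; simp
    have hV : (IsDiscreteValuationRing.maximalIdeal ℤ_[p]).valuation ℚ_[p] X'.Δ = 1 := by
      rw [← integralModel_Δ_eq ℤ_[p] X']
      exact (addVal_eq_zero_iff_valuation_eq_one (K := ℚ_[p]) _).mp h0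
    exact ⟨hV⟩
  · rw [localRootNumber_padic_of_hasAdditiveReduction p _ hp5 hadd, if_neg hj, ← hI, hΔ]
    have e2 : 12 / Nat.gcd 6 12 = 2 := by decide
    simp only [ENat.toNat_coe, e2]
    simp

/-- **`N_{E^{(p*)}}·p² = N_E` when `E` is additive and `E^{(p*)}` GOOD at `p`** (type I₀*): `f_p(E') = 0`, and away from `p` the twist is by a unit,
so the exponents agree (`factorization_conductorNorm_quadraticTwist_eq_of_not_dvd`). [cite: Silverman1994, IV.10.2 and IV.10.4] -/
theorem conductorNorm_pStarTwist_mul_sq_eq_of_good (W : WeierstrassCurve ℚ) [W.IsElliptic] (hp5 : 5 ≤ p)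
    [(W.quadraticTwist (((-1 : ℤ) ^ (p / 2) * p : ℤ) : ℚ)).IsElliptic] {M : ℕ} (hN : W.conductorNorm ℤ = M * p ^ 2) (hpM : ¬ p ∣ M)
    (hgood : (((W.quadraticTwist (((-1 : ℤ) ^ (p / 2) * p : ℤ) : ℚ)).baseChange ℚ_[p]).minimal ℤ_[p]).HasGoodReduction ℤ_[p]) :
    (W.quadraticTwist (((-1 : ℤ) ^ (p / 2) * p : ℤ) : ℚ)).conductorNorm ℤ = M := by
  have hp : p.Prime := Fact.out
  have hp2 : p ≠ 2 := by omega
  set N' := (W.quadraticTwist (((-1 : ℤ) ^ (p / 2) * p : ℤ) : ℚ)).conductorNorm ℤ with hN'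
  have hN'0 : N' ≠ 0 := ((W.quadraticTwist _).conductorNorm_pos_holds).ne'
  have hM0 : M ≠ 0 := fun h ↦ (W.conductorNorm_pos_holds).ne' (by rw [hN, h, zero_mul])
  have hgen : ∀ q : Nat.Primes, natGenerator ((primesEquiv (R := ℤ)).symm q) = q := fun q ↦
    congrArg (fun q : Nat.Primes ↦ (q : ℕ)) ((primesEquiv (R := ℤ)).apply_symm_apply q)
  refine Nat.eq_of_factorization_eq hN'0 hM0 fun q ↦ ?_
  by_cases hq : q.Prime
  swap
  · rw [Nat.factorization_eq_zero_of_not_prime _ hq, Nat.factorization_eq_zero_of_not_prime _ hq]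
  set vq : HeightOneSpectrum ℤ := (primesEquiv (R := ℤ)).symm ⟨q, hq⟩ with hvq
  have hgenq : natGenerator vq = q := by rw [hvq]; exact hgen ⟨q, hq⟩
  by_cases hqp : q = p
  · -- at `p`: `f_p(E') = 0` and `p ∤ M`
    subst hqp
    have hgood' : (W.quadraticTwist (((-1 : ℤ) ^ (q / 2) * q : ℤ) : ℚ)).HasGoodReductionAt vq :=
      ((W.quadraticTwist _).hasGoodReductionAtPrime_iff_hasGoodReductionAt_holds ⟨q, hq⟩).mp hgood
    have h0 := ((conductorExponent_eq_zero_iff_holds vq (W.quadraticTwist (((-1 : ℤ) ^ (q / 2) * q : ℤ) : ℚ))).mpr hgood')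
    have hf := factorization_conductorNorm_holds (W.quadraticTwist (((-1 : ℤ) ^ (q / 2) * q : ℤ) : ℚ)) vq
    rw [hgenq] at hf
    rw [hf, h0, Nat.factorization_eq_zero_of_not_dvd hpM]
  · -- away from `p`: the twist is by a unit
    have hqd : ¬ ((natGenerator vq : ℕ) : ℤ) ∣ (-1 : ℤ) ^ (p / 2) * p := by
      rw [hgenq]; exact fun h ↦ hqp (eq_of_prime_dvd_pStar hq h)
    have h := W.factorization_conductorNorm_quadraticTwist_eq_of_not_dvd (pStar_emod_four hp2) vq hqd
    rw [hgenq] at h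
    rw [h, hN, Nat.factorization_mul hM0 (pow_ne_zero 2 hp.ne_zero), Finsupp.add_apply, Nat.factorization_pow,
      Finsupp.smul_apply, hp.factorization, Finsupp.single_eq_of_ne hqp, smul_zero, add_zero]

/-- **`w(E)·w(E') = (M/p)·λ_p(f)` when `N_E = M p²` and `N_{E'} = M`** (`E' = E^{(p*)}` good at `p`, `M` squarefree): Atkin–Lehner-formal as in
part 2, the level of `f'` having no `p`-part. [cite: Knapp1993, Thm. 9.27] [cite: AtkinLehner1970, Thm. 3 and §6] -/
theorem rootNumber_mul_rootNumber_pStarTwist_eq_legendreSym_mul_of_good (W : WeierstrassCurve ℚ) [W.IsElliptic]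
    [NeZero (W.conductorNorm ℤ)] (hp2 : p ≠ 2) {M : ℕ} (hN : W.conductorNorm ℤ = M * p ^ 2) (hM : Squarefree M)
    (hpM : ¬ p ∣ M) [(W.quadraticTwist (((-1 : ℤ) ^ (p / 2) * p : ℤ) : ℚ)).IsElliptic]
    [NeZero ((W.quadraticTwist (((-1 : ℤ) ^ (p / 2) * p : ℤ) : ℚ)).conductorNorm ℤ)]
    (hN' : (W.quadraticTwist (((-1 : ℤ) ^ (p / 2) * p : ℤ) : ℚ)).conductorNorm ℤ = M)
    {f : CuspForm (Gamma0 (W.conductorNorm ℤ)) 2} (hf : IsNewformOf W f)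
    {f' : CuspForm (Gamma0 ((W.quadraticTwist (((-1 : ℤ) ^ (p / 2) * p : ℤ) : ℚ)).conductorNorm ℤ)) 2}
    (hf' : IsNewformOf (W.quadraticTwist (((-1 : ℤ) ^ (p / 2) * p : ℤ) : ℚ)) f') :
    ((W.rootNumber * (W.quadraticTwist (((-1 : ℤ) ^ (p / 2) * p : ℤ) : ℚ)).rootNumber : ℤ) : ℂ) =
      legendreSym p M * atkinLehnerEigenvalueAt f p := by
  have hp : p.Prime := Fact.out
  have hw : (W.rootNumber : ℂ) = -frickeEigenvalue f :=
    Literature.NumberTheory.EllipticCurves.rootNumber_eq_neg_of_frickeInvolution_eq_smul W hf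
      (IsNewform0.frickeEigenvalue_eq_one_or_eq_neg_one_holds hf.1) (IsNewform0.frickeInvolution_eq_smul_holds hf.1)
  have hw' : ((W.quadraticTwist (((-1 : ℤ) ^ (p / 2) * p : ℤ) : ℚ)).rootNumber : ℂ) = -frickeEigenvalue f' :=
    Literature.NumberTheory.EllipticCurves.rootNumber_eq_neg_of_frickeInvolution_eq_smul _ hf'
      (IsNewform0.frickeEigenvalue_eq_one_or_eq_neg_one_holds hf'.1) (IsNewform0.frickeInvolution_eq_smul_holds hf'.1)
  have hε := IsNewform0.frickeEigenvalue_eq_prod_atkinLehnerEigenvalueAt_holds hf.1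
  have hε' := IsNewform0.frickeEigenvalue_eq_prod_atkinLehnerEigenvalueAt_holds hf'.1
  have hM0 : M ≠ 0 := hM.ne_zero
  have hpf : (W.conductorNorm ℤ).primeFactors = insert p M.primeFactors := by
    rw [hN, Nat.primeFactors_mul hM0 (pow_ne_zero 2 hp.ne_zero), Nat.primeFactors_pow _ two_ne_zero, hp.primeFactors,
      Finset.union_comm]
    rfl
  have hpf' : ((W.quadraticTwist (((-1 : ℤ) ^ (p / 2) * p : ℤ) : ℚ)).conductorNorm ℤ).primeFactors = M.primeFactors := by rw [hN']
  have hpnot : p ∉ M.primeFactors := fun h ↦ hpM (Nat.dvd_of_mem_primeFactors h)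
  have hq : ∀ q ∈ M.primeFactors, atkinLehnerEigenvalueAt f q * atkinLehnerEigenvalueAt f' q = legendreSym p q := by
    intro q hqM
    have hqp : q.Prime := Nat.prime_of_mem_primeFactors hqM
    haveI := Fact.mk hqp
    have hqdM : q ∣ M := Nat.dvd_of_mem_primeFactors hqM
    have hqnep : q ≠ p := fun h ↦ hpnot (h ▸ hqM)
    have hpq : ¬ p ∣ q := fun h ↦ hqnep ((Nat.prime_dvd_prime_iff_eq hp hqp).mp h).symm
    obtain ⟨M₁, hM₁⟩ := hqdM
    have hqM₁ : ¬ q ∣ M₁ := by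
      rintro ⟨M₂, rfl⟩
      exact hqp.one_lt.ne' (Nat.isUnit_iff.mp (hM q ⟨M₂, by rw [hM₁]; ring⟩))
    have hqrest : ¬ q ∣ M₁ * p ^ 2 := by
      intro h
      rcases (Nat.Prime.dvd_mul hqp).mp h with h | h
      · exact hqM₁ h
      · exact hqnep ((Nat.prime_dvd_prime_iff_eq hqp hp).mp (hqp.dvd_of_dvd_pow h))
    have hNq : W.conductorNorm ℤ = q * (M₁ * p ^ 2) := by rw [hN, hM₁]; ring
    have hNq' : (W.quadraticTwist (((-1 : ℤ) ^ (p / 2) * p : ℤ) : ℚ)).conductorNorm ℤ = q * M₁ := by rw [hN', hM₁]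
    have h1 : atkinLehnerEigenvalueAt f q = -cuspCoeff f q :=
      hf.1.atkinLehnerEigenvalueAt_eq_neg_coeff_of_not_dvd q hNq hqrest
    have h2 : atkinLehnerEigenvalueAt f' q = -cuspCoeff f' q :=
      hf'.1.atkinLehnerEigenvalueAt_eq_neg_coeff_of_not_dvd q hNq' hqM₁
    have h3 : cuspCoeff f' q = legendreSym p q * cuspCoeff f q := by
      rw [hf.2 q, hf'.2 q, W.LFunction_quadraticTwist_pStar_apply hp2 hpq]
      push_cast
      ring
    have h1' : cuspCoeff f q = -atkinLehnerEigenvalueAt f q := by rw [h1, neg_neg]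
    have h4 : atkinLehnerEigenvalueAt f q * atkinLehnerEigenvalueAt f q = 1 := by
      rcases hf.1.atkinLehnerEigenvalueAt_eq_one_or_eq_neg_one hqp (hNq ▸ dvd_mul_right q _) with h | h <;>
        rw [h] <;> norm_num
    calc atkinLehnerEigenvalueAt f q * atkinLehnerEigenvalueAt f' q
        = legendreSym p q * (atkinLehnerEigenvalueAt f q * atkinLehnerEigenvalueAt f q) := by
          rw [h2, h3, h1']; ring
      _ = legendreSym p q := by rw [h4, mul_one]
  have hleg : ∏ q ∈ M.primeFactors, (legendreSym p q : ℂ) = legendreSym p M := by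
    conv_rhs => rw [← Nat.prod_primeFactors_of_squarefree hM]
    rw [Nat.cast_prod, ← legendreSym.hom_apply, map_prod]
    push_cast
    simp only [legendreSym.hom_apply]
  rw [Int.cast_mul, hw, hw', hε, hε', hpf, hpf', Finset.prod_insert hpnot, neg_mul_neg, mul_assoc, ← Finset.prod_mul_distrib,
    Finset.prod_congr rfl hq, hleg]
  ring

/-- **TYPE I₀*: `w(E)·w(E^{(p*)}) = (M/p)·(−1/p)`, UNCONDITIONAL modulo the Modularity Theorem.** `E/ℚ` of conductor `N = M p²` (`p ≥ 5`,
`M` squarefree, `p ∤ M`) whose minimal model at `p` has `ord_p Δ = 6`, `ord_p c₄ > 0`, `3 ord_p c₄ ≥ ord_p Δ` (type I₀*, `e = 2`). Here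
`E^{(p*)}` is GOOD at `p` and Kellock–Dokchitser's Rem. 2.2 at `p` is the tree's THEOREM `atkinLehnerEigenvalueAt_eq_localRootNumberAt_of_twist`
(quadratic-twist type), so only `exists_isNewformOf` is assumed. [cite: KellockDokchitser2023, Rem. 2.2 and Thm. 2.3] [cite: Rohrlich1993Compositio, Prop. 2(iv)] -/
theorem rootNumber_mul_rootNumber_pStarTwist_of_six (W : WeierstrassCurve ℚ) [W.IsElliptic] (hmod : exists_isNewformOf) (hp5 : 5 ≤ p)
    {M : ℕ} (hN : W.conductorNorm ℤ = M * p ^ 2) (hM : Squarefree M) (hpM : ¬ p ∣ M)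
    (hΔ : addVal ℤ_[p] (((W.baseChange ℚ_[p]).minimal ℤ_[p]).integralModel ℤ_[p]).Δ = (6 : ℕ))
    (hc₄ : addVal ℤ_[p] (((W.baseChange ℚ_[p]).minimal ℤ_[p]).integralModel ℤ_[p]).c₄ ≠ 0)
    (hj : ¬ 3 * addVal ℤ_[p] (((W.baseChange ℚ_[p]).minimal ℤ_[p]).integralModel ℤ_[p]).c₄ <
      addVal ℤ_[p] (((W.baseChange ℚ_[p]).minimal ℤ_[p]).integralModel ℤ_[p]).Δ) :
    W.rootNumber * (W.quadraticTwist (((-1 : ℤ) ^ (p / 2) * p : ℤ) : ℚ)).rootNumber = legendreSym p M * ZMod.χ₄ p := by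
  have hp : p.Prime := Fact.out
  have hp2 : p ≠ 2 := by omega
  have hdZ0 : ((-1 : ℤ) ^ (p / 2) * p : ℤ) ≠ 0 :=
    mul_ne_zero (pow_ne_zero _ (by norm_num)) (by exact_mod_cast hp.ne_zero)
  have hd0 : (((((-1 : ℤ) ^ (p / 2) * p : ℤ)) : ℚ)) ≠ 0 := by exact_mod_cast hdZ0
  haveI hE' : (W.quadraticTwist (((-1 : ℤ) ^ (p / 2) * p : ℤ) : ℚ)).IsElliptic := W.isElliptic_quadraticTwist hd0
  haveI : NeZero (W.conductorNorm ℤ) := ⟨(W.conductorNorm_pos_holds).ne'⟩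
  haveI : NeZero ((W.quadraticTwist (((-1 : ℤ) ^ (p / 2) * p : ℤ) : ℚ)).conductorNorm ℤ) :=
    ⟨((W.quadraticTwist _).conductorNorm_pos_holds).ne'⟩
  obtain ⟨hadd, hgood, hroot⟩ := hasGoodReduction_pStarTwist_padic_of_six W hp5 hΔ hc₄ hj
  have hN' := conductorNorm_pStarTwist_mul_sq_eq_of_good W hp5 hN hpM hgood
  obtain ⟨f, hf⟩ := hmod W
  obtain ⟨f', hf'⟩ := hmod (W.quadraticTwist (((-1 : ℤ) ^ (p / 2) * p : ℤ) : ℚ))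
  have h0 := rootNumber_mul_rootNumber_pStarTwist_eq_legendreSym_mul_of_good W hp2 hN hM hpM hN' hf hf'
  -- Kellock–Dokchitser at the twist-type prime `p` is a theorem of the tree
  set P : Nat.Primes := ⟨p, hp⟩ with hP
  have hgen : ∀ q : Nat.Primes, natGenerator ((primesEquiv (R := ℤ)).symm q) = q := fun q ↦
    congrArg (fun q : Nat.Primes ↦ (q : ℕ)) ((primesEquiv (R := ℤ)).apply_symm_apply q)
  have haddZ : W.HasAdditiveReductionAt ((primesEquiv (R := ℤ)).symm P) :=
    (W.hasAdditiveReduction_padic_iff_hasAdditiveReductionAt_int P).mp hadd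
  have hsemi : ¬ (W.quadraticTwist (((-1 : ℤ) ^ ((P : ℕ) / 2) * P : ℤ) : ℚ)).HasAdditiveReductionAt
      ((primesEquiv (R := ℤ)).symm P) := fun h ↦
    (((W.quadraticTwist _).hasAdditiveReduction_padic_iff_hasAdditiveReductionAt_int P).mpr h).not_hasGoodReduction _ hgood
  -- `E` has additive reduction only above `p` (`M` squarefree)
  have h23 : ∀ v : HeightOneSpectrum ℤ, W.HasAdditiveReductionAt v → 3 < ringChar (ℤ ⧸ v.asIdeal) := by
    intro v hv
    rw [Rat.ringChar_int_quotient_asIdeal]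
    have h2 := (two_le_conductorExponent_iff_holds v W).mpr hv
    rw [← factorization_conductorNorm_holds W v, hN] at h2
    set q := natGenerator v with hq
    by_contra hle
    have hqp : q ≠ p := by intro h; rw [h] at hle; omega
    rw [Nat.factorization_mul hM.ne_zero (pow_ne_zero 2 hp.ne_zero), Finsupp.add_apply, Nat.factorization_pow, Finsupp.smul_apply,
      hp.factorization, Finsupp.single_eq_of_ne hqp, smul_zero, add_zero] at h2
    have h1 := (Nat.squarefree_iff_factorization_le_one hM.ne_zero).mp hM q
    omega
  have hl : atkinLehnerEigenvalueAt f p = ((W.baseChange ℚ_[p]).localRootNumber ℤ_[p] : ℂ) := by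
    rw [← localRootNumberAt_primesEquiv_symm_holds W P]
    exact W.atkinLehnerEigenvalueAt_eq_localRootNumberAt_of_twist hmod hf P hp5 haddZ hsemi h23
  rw [hl, hroot] at h0
  exact_mod_cast h0

/-- **TYPE I₀* IN THE RAMIFIED HABITAT: `w(E)·w(E^{(d)}) = −1`, unconditional modulo Modularity.** `E` as in
`rootNumber_mul_rootNumber_pStarTwist_of_six`; `d = p*·d'` with `d' ≡ 1 (4)` squarefree prime to `N`, `d < 0`, every prime of `M` split in
`ℚ(√d)`. Then `w(E)·w(E^{(d)}) = −1` (`e = 2 ∣ p − 1`: principal series; the completion of the card's sign table on the potentially good rows).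
[cite: MurtyMurty1997, Ch. 6 §1] [cite: Rohrlich1993Compositio, Prop. 2(iv)] -/
theorem rootNumber_mul_rootNumber_ramifiedTwist_of_six (W : WeierstrassCurve ℚ) [W.IsElliptic] (hmod : exists_isNewformOf)
    (hp5 : 5 ≤ p) {M : ℕ} (hN : W.conductorNorm ℤ = M * p ^ 2) (hM : Squarefree M) (hpM : ¬ p ∣ M)
    (hΔ : addVal ℤ_[p] (((W.baseChange ℚ_[p]).minimal ℤ_[p]).integralModel ℤ_[p]).Δ = (6 : ℕ))
    (hc₄ : addVal ℤ_[p] (((W.baseChange ℚ_[p]).minimal ℤ_[p]).integralModel ℤ_[p]).c₄ ≠ 0)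
    (hj : ¬ 3 * addVal ℤ_[p] (((W.baseChange ℚ_[p]).minimal ℤ_[p]).integralModel ℤ_[p]).c₄ <
      addVal ℤ_[p] (((W.baseChange ℚ_[p]).minimal ℤ_[p]).integralModel ℤ_[p]).Δ)
    {d' : ℤ} (hd'4 : d' % 4 = 1) (hd'sq : Squarefree d') (hgcd : Int.gcd d' (W.conductorNorm ℤ) = 1)
    (hneg : (-1 : ℤ) ^ (p / 2) * p * d' < 0)
    (hodd : ∀ q ∈ M.primeFactors, q ≠ 2 → J((-1 : ℤ) ^ (p / 2) * p * d' | q) = 1)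
    (htwo : 2 ∣ M → ((-1 : ℤ) ^ (p / 2) * p * d') % 8 = 1) :
    W.rootNumber * (W.quadraticTwist (((-1 : ℤ) ^ (p / 2) * p * d' : ℤ) : ℚ)).rootNumber = -1 := by
  have hp : p.Prime := Fact.out
  have hp2 : p ≠ 2 := by omega
  have hdZ0 : ((-1 : ℤ) ^ (p / 2) * p : ℤ) ≠ 0 :=
    mul_ne_zero (pow_ne_zero _ (by norm_num)) (by exact_mod_cast hp.ne_zero)
  have hd0 : (((((-1 : ℤ) ^ (p / 2) * p : ℤ)) : ℚ)) ≠ 0 := by exact_mod_cast hdZ0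
  haveI hE' : (W.quadraticTwist (((-1 : ℤ) ^ (p / 2) * p : ℤ) : ℚ)).IsElliptic := W.isElliptic_quadraticTwist hd0
  have hA := rootNumber_mul_rootNumber_pStarTwist_of_six W hmod hp5 hN hM hpM hΔ hc₄ hj
  obtain ⟨-, hgood, -⟩ := hasGoodReduction_pStarTwist_padic_of_six W hp5 hΔ hc₄ hj
  have hN' := conductorNorm_pStarTwist_mul_sq_eq_of_good W hp5 hN hpM hgood
  have hgcd' : Int.gcd d' ((W.quadraticTwist (((-1 : ℤ) ^ (p / 2) * p : ℤ) : ℚ)).conductorNorm ℤ) = 1 := by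
    rw [hN']
    have h1 := Int.isCoprime_iff_gcd_eq_one.mpr hgcd
    rw [hN] at h1
    push_cast at h1
    exact Int.isCoprime_iff_gcd_eq_one.mp h1.of_mul_right_left
  have hB := ((W.quadraticTwist (((-1 : ℤ) ^ (p / 2) * p : ℤ) : ℚ)).rootNumber_quadraticTwist_of_emod_four_eq_one
    hmod hd'4 hd'sq hgcd').1
  rw [quadraticTwist_quadraticTwist, hN'] at hB
  have hcast : ((((-1 : ℤ) ^ (p / 2) * p : ℤ) : ℚ)) * (d' : ℚ) = (((-1 : ℤ) ^ (p / 2) * p * d' : ℤ) : ℚ) := by push_cast; ring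
  rw [hcast] at hB
  have hNe0 : NeZero d'.natAbs := ⟨Int.natAbs_ne_zero.mpr (by rintro rfl; norm_num at hd'4)⟩
  have hJM : J((M : ℤ) | d'.natAbs) = legendreSym p M := jacobiSym_natAbs_eq_legendreSym_of_split hp2 hd'4 hM hodd htwo
  have hJ1 := jacobiSym_neg_one_natAbs_eq_of_neg hp2 hd'4 hneg
  have hM2 : legendreSym p M * legendreSym p M = 1 := by
    rw [← sq]
    refine legendreSym.sq_one p ?_
    rw [Int.cast_natCast, ne_eq, ZMod.natCast_eq_zero_iff]
    exact hpM
  have hχ₄ : ZMod.χ₄ p * ZMod.χ₄ p = 1 := by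
    have hp' := (Nat.Prime.eq_two_or_odd hp).resolve_left hp2
    rw [ZMod.χ₄_nat_eq_if_mod_four]
    have : p % 4 = 1 ∨ p % 4 = 3 := by omega
    have h2' : p % 2 ≠ 0 := by omega
    rcases this with h | h <;> simp [h, h2']
  calc W.rootNumber * (W.quadraticTwist (((-1 : ℤ) ^ (p / 2) * p * d' : ℤ) : ℚ)).rootNumber
      = J(-1 | d'.natAbs) * J((M : ℤ) | d'.natAbs) *
          (W.rootNumber * (W.quadraticTwist (((-1 : ℤ) ^ (p / 2) * p : ℤ) : ℚ)).rootNumber) := by rw [hB]; ring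
    _ = -ZMod.χ₄ p * legendreSym p M * (legendreSym p M * ZMod.χ₄ p) := by rw [hJ1, hJM, hA]
    _ = -1 := by linear_combination (-(ZMod.χ₄ p * ZMod.χ₄ p)) * hM2 - hχ₄

end IZeroStar

end Summit.BirchSwinnertonDyer.BirchSwinnertonDyer.Theorems.AdditiveKoly.RamifiedHabitat

end
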